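import Summits.RiemannHypothesis.RiemannHypothesis.Theses.RuelleBand
import Literature.NumberTheory.LFunctions.ZetaLogDerivRePartialFraction
import Literature.NumberTheory.LFunctions.ZetaZerosProofs
import Literature.NumberTheory.LFunctions.ZetaZerosReflection
import Literature.NumberTheory.LFunctions.RHWave0HardyProofs
import Literature.NumberTheory.LFunctions.GeneralizedRH
import Literature.NumberTheory.LFunctions.RiemannXiProofs
import Literature.Analysis.Complex.LittlewoodLemma
import Summits.RiemannHypothesis.RiemannHypothesis.Theorems.CofiniteCriticalLine.Negative.Reformulations

/-!
# `CofiniteCriticalLine` (crux stmt-RiemannHypothesis-2064) ⟺ cofinite Lagarias positivity ⟺ cofinite horizontal monotonicity of `|ξ|`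

The crux of route RuelleBand, rank 5, is
`CofiniteCriticalLine := {s : ℂ | riemannZeta s = 0 ∧ 0 < s.re ∧ s.re < 1 ∧ s.re ≠ 1 / 2}.Finite`.
Refuter's standing-adversary output (cdisprove cycle 2), kernel-checked, statements inline, no new definitions
(the reflection `ρ ↦ 1 − ρ̄` is used as a permutation of the subtype of non-trivial zeros inside the proof).
Consequences for crux idea `rate-band-collar-split` are in the sibling file `CollarCostume.lean`.

* `re_logDeriv_riemannXi_pos_of_offLine` — **pointwise symmetrised Sondow–Dumitrescu / Lagarias criterion**:
  if `re s > 1/2` and every OFF-LINE zero `ρ = β + iγ` satisfies `(β − 1/2)² < (σ − 1/2)² + (t − γ)²`, then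
  `Re ξ'/ξ(s) > 0`. Proof: the tree's partial fraction with multiplicities
  `Re ξ'/ξ(s) = Σ_ρ m(ρ) Re 1/(s − ρ)` (`Literature.NumberTheory.LFunctions.hasSum_zeroOrder_mul_re_inv_sub`,
  PROVED), re-indexed by the multiplicity-preserving involution `ρ ↦ 1 − ρ̄`
  (`riemannZetaZeroOrder_conj_holds`, `riemannZetaZeroOrder_one_sub_holds`), and the pair computation
  `(x − a)/((x − a)² + u²) + (x + a)/((x + a)² + u²) = 2x(x² − a² + u²)/D` (`msz_pair_pos`): a symmetric pair
  of zeros `1/2 ± a + iγ` pushes `|ξ|` outward at every point outside the disc of radius `|a|` about `1/2 + iγ`.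
  Special cases: void hypothesis under RH (Lagarias (1.5) / Hinkkanen / Sondow–Dumitrescu = MSZ Thm 1.1); on
  `re s ≥ 1` (`re_logDeriv_riemannXi_pos_of_one_le_re`: Lagarias (1.4) on the CLOSED half-plane, unconditionally);
  at every height `t` at distance `≥ 1/2` from all off-line ordinates (`re_logDeriv_riemannXi_pos_of_offLine_height`).
* `strictMonoOn_norm_riemannXi_of_re_logDeriv_pos` — MSZ Lemma 2.3 for `ξ` on the ray `[1/2, ∞) + it`
  (tree: `Literature.Analysis.Complex.hasDerivAt_log_norm_horizontal`; endpoint by continuity).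
* `cofiniteCriticalLine_iff_eventually_re_logDeriv_pos` — **crux ⟺ ∃ T, Re ξ'/ξ(σ + it) > 0 for all σ > 1/2,
  |t| ≥ T** (cofinite Lagarias positivity; `⟸` is cheap: Mathlib's `logDeriv` vanishes at a zero).
* `cofiniteCriticalLine_iff_eventually_strictMonoOn` — **crux ⟺ ∃ T, σ ↦ |ξ(σ + it)| strictly increasing on
  [1/2, ∞) for all |t| ≥ T** (cofinite Sondow–Dumitrescu; `⟸` by isolated zeros of `ξ`, `ξ(0) = 1/2`, already from
  monotonicity on `[1/2, 1/2 + ε₀]`, `ε₀ ≥ 1/2`: `cofinite_of_eventually_monotoneOn`).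

References: Sondow–Dumitrescu 2010 (Period. Math. Hungar. 60), Thm 1; Matiyasevich–Saidak–Zvengrowski 2014
(Acta Arith. 166 = arXiv:1205.2773), Thm 1.1, Lemmas 2.1/2.3, Cor. 2.5 (READ, pp. 3–5 of the arXiv text);
Lagarias 1999 (Acta Arith. 89), (1.4)–(1.5) (tree: `LagariasXiPositivity.lean`).
-/

noncomputable section

open Complex Set Filter Topology
open scoped ComplexConjugate

namespace Summit.RiemannHypothesis.Cruxes.CofiniteCriticalLine.Negative

open Summit.RiemannHypothesis.RiemannHypothesis.Theses.RuelleBand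
open Literature.NumberTheory.LFunctions

/-! ## The non-trivial zeros as a subtype, and the reflection `ρ ↦ 1 − ρ̄` -/

/-- Membership in the tree's set of non-trivial zeros (`RHWave0.riemannZetaNontrivialZeros`) is
`ζ ρ = 0 ∧ 0 < re ρ < 1` (tree: `mem_riemannZetaNontrivialZeros_iff_holds`). [folklore] -/
theorem mem_nontrivialZeros_iff {ρ : ℂ} :
    ρ ∈ RHWave0.riemannZetaNontrivialZeros ↔ riemannZeta ρ = 0 ∧ 0 < ρ.re ∧ ρ.re < 1 :=
  mem_riemannZetaNontrivialZeros_iff_holds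

/-- The zero set of `ζ` in the strip is stable under `ρ ↦ 1 − ρ̄` (conjugation `riemannZeta_conj` and the
functional equation, tree lemma `GeneralizedRH.riemannZeta_one_sub_eq_zero`). [folklore] -/
theorem one_sub_conj_mem_nontrivialZeros {ρ : ℂ} (hρ : ρ ∈ RHWave0.riemannZetaNontrivialZeros) :
    1 - conj ρ ∈ RHWave0.riemannZetaNontrivialZeros := by
  rw [mem_nontrivialZeros_iff] at hρ ⊢
  obtain ⟨hz, h0, h1⟩ := hρ
  have hzc : riemannZeta (conj ρ) = 0 := by rw [riemannZeta_conj, hz, map_zero]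
  refine ⟨GeneralizedRH.riemannZeta_one_sub_eq_zero hzc (by simpa using h0) (by simpa using h1), ?_, ?_⟩
  · simp only [sub_re, one_re, conj_re]; linarith
  · simp only [sub_re, one_re, conj_re]; linarith

/-- The multiplicity is invariant under `ρ ↦ 1 − ρ̄` (tree: `riemannZetaZeroOrder_conj_holds`,
`riemannZetaZeroOrder_one_sub_holds`). [folklore] -/
theorem zeroOrder_one_sub_conj (ρ : RHWave0.riemannZetaNontrivialZeros) :
    riemannZetaZeroOrder (1 - conj (ρ : ℂ)) = riemannZetaZeroOrder (ρ : ℂ) := by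
  obtain ⟨-, h0, h1⟩ := mem_nontrivialZeros_iff.1 ρ.2
  rw [riemannZetaZeroOrder_one_sub_holds (by simpa using h0) (by simpa using h1)]
  exact riemannZetaZeroOrder_conj_holds ρ

/-- Every non-trivial zero has positive multiplicity. [folklore] -/
theorem zeroOrder_pos (ρ : RHWave0.riemannZetaNontrivialZeros) : 0 < riemannZetaZeroOrder (ρ : ℂ) := by
  obtain ⟨hz, -, h1⟩ := mem_nontrivialZeros_iff.1 ρ.2
  refine (riemannZetaZeroOrder_pos_iff ?_).2 hz
  intro h; rw [h] at h1; norm_num at h1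

/-- There is a non-trivial zero (Hardy's theorem, proved in tree, gives infinitely many on the line).
[folklore] -/
theorem nonempty_nontrivialZeros : Nonempty RHWave0.riemannZetaNontrivialZeros := by
  obtain ⟨t, ht⟩ := hardy_infinite_zeros_on_critical_line_holds.nonempty
  refine ⟨⟨1 / 2 + t * I, mem_nontrivialZeros_iff.2 ⟨ht, ?_, ?_⟩⟩⟩ <;> norm_num

/-- Bookkeeping: if no zero with `1/2 < re s < 1` has height `≥ T`, the crux holds (reflect the left half
by `s ↦ 1 − s`, tree lemma `GeneralizedRH.riemannZeta_one_sub_eq_zero`; zeros of bounded height are finitely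
many, Mathlib `IsCompact.inter_riemannZetaZeros_finite`). [folklore] -/
theorem cofinite_of_no_rightHalf_zero_above {T : ℝ}
    (key : ∀ s : ℂ, riemannZeta s = 0 → 1 / 2 < s.re → s.re < 1 → T ≤ |s.im| → False) :
    CofiniteCriticalLine := by
  refine (((isCompact_Icc (a := (0 : ℝ)) (b := 1)).reProdIm
    (isCompact_Icc (a := -T) (b := T))).inter_riemannZetaZeros_finite).subset ?_
  rintro s ⟨hz, h0, h1, hne⟩
  refine ⟨Complex.mem_reProdIm.2 ⟨⟨h0.le, h1.le⟩, abs_le.1 (le_of_not_gt fun hT => ?_)⟩, hz⟩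
  rcases lt_or_gt_of_ne hne with hlt | hgt
  · refine key (1 - s) (GeneralizedRH.riemannZeta_one_sub_eq_zero hz h0 h1) ?_ ?_ ?_
    · simp only [sub_re, one_re]; linarith
    · simp only [sub_re, one_re]; linarith
    · simp only [sub_im, one_im, zero_sub, abs_neg]; exact hT.le
  · exact key s hz hgt h1 hT.le

/-! ## The Matiyasevich–Saidak–Zvengrowski pair computation -/

/-- MSZ pair lemma: for `x > 0` and `a² < x² + u²`,
`(x − a)/((x − a)² + u²) + (x + a)/((x + a)² + u²) > 0` (it equals `2x(x² − a² + u²)/D`). [folklore] -/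
theorem msz_pair_pos {x a u : ℝ} (hx : 0 < x) (h : a ^ 2 < x ^ 2 + u ^ 2) :
    0 < (x - a) / ((x - a) ^ 2 + u ^ 2) + (x + a) / ((x + a) ^ 2 + u ^ 2) := by
  have hP : 0 < (x - a) ^ 2 + u ^ 2 := by
    by_contra hP
    have h1 : (x - a) ^ 2 + u ^ 2 = 0 := le_antisymm (not_lt.1 hP) (by positivity)
    have hxa : x - a = 0 := by nlinarith [sq_nonneg (x - a), sq_nonneg u]
    have hu : u = 0 := by nlinarith [sq_nonneg (x - a), sq_nonneg u]
    have : a = x := by linarith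
    rw [this, hu] at h; simp at h
  have hQ : 0 < (x + a) ^ 2 + u ^ 2 := by
    by_contra hQ
    have h1 : (x + a) ^ 2 + u ^ 2 = 0 := le_antisymm (not_lt.1 hQ) (by positivity)
    have hxa : x + a = 0 := by nlinarith [sq_nonneg (x + a), sq_nonneg u]
    have hu : u = 0 := by nlinarith [sq_nonneg (x + a), sq_nonneg u]
    have : a = -x := by linarith
    rw [this, hu] at h; simp at h
  rw [div_add_div _ _ hP.ne' hQ.ne']
  refine div_pos ?_ (mul_pos hP hQ)
  have hid : (x - a) * ((x + a) ^ 2 + u ^ 2) + ((x - a) ^ 2 + u ^ 2) * (x + a) =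
      2 * x * (x ^ 2 - a ^ 2 + u ^ 2) := by ring
  rw [hid]
  have : 0 < x ^ 2 - a ^ 2 + u ^ 2 := by linarith
  positivity

/-- The pair lemma in zero coordinates: `σ > 1/2`, `(β − 1/2)² < (σ − 1/2)² + (t − γ)²` give
`(σ − β)/|s − ρ|² + (σ − (1 − β))/|s − (1 − ρ̄)|² > 0` (`ρ = β + iγ`, `1 − ρ̄ = (1 − β) + iγ`). [folklore] -/
theorem msz_pair_pos' {σ β t γ : ℝ} (hσ : 1 / 2 < σ) (h : (β - 1 / 2) ^ 2 < (σ - 1 / 2) ^ 2 + (t - γ) ^ 2) :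
    0 < (σ - β) / ((σ - β) ^ 2 + (t - γ) ^ 2) + (σ - (1 - β)) / ((σ - (1 - β)) ^ 2 + (t - γ) ^ 2) := by
  have h' := msz_pair_pos (x := σ - 1 / 2) (a := β - 1 / 2) (u := t - γ) (by linarith) h
  have e1 : σ - 1 / 2 - (β - 1 / 2) = σ - β := by ring
  have e2 : σ - 1 / 2 + (β - 1 / 2) = σ - (1 - β) := by ring
  rw [e1, e2] at h'
  exact h'

/-- `Re 1/(s − ρ) = (σ − β)/((σ − β)² + (t − γ)²)`. [folklore] -/
theorem re_inv_sub_eq' (s ρ : ℂ) :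
    (1 / (s - ρ)).re = (s.re - ρ.re) / ((s.re - ρ.re) ^ 2 + (s.im - ρ.im) ^ 2) := by
  rw [IsHadamardSeq.re_inv_sub_eq, Complex.sq_norm, Complex.normSq_apply]
  simp only [sub_re, sub_im]
  ring

/-! ## Pointwise MSZ criterion for `Re ξ'/ξ > 0` -/

/-- **Pointwise symmetrised Sondow–Dumitrescu / Lagarias criterion.** Let `re s > 1/2` and suppose every
OFF-LINE zero `ρ = β + iγ` of `ζ` satisfies `(β − 1/2)² < (σ − 1/2)² + (t − γ)²` (i.e. `s` lies outside
the closed disc centred at `1/2 + iγ` of radius `|β − 1/2| < 1/2`). Then `Re ξ'/ξ(s) > 0`.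
Proof: `Re ξ'/ξ(s) = Σ_ρ m(ρ) Re 1/(s − ρ)` (tree, `hasSum_zeroOrder_mul_re_inv_sub`); symmetrise over
`ρ ↦ 1 − ρ̄` (same multiplicity) and apply the pair lemma. The unsymmetrised argument (`σ >` every `Re ρ`
⟹ every term positive) is Sondow–Dumitrescu's Thm 1 as re-proved by Matiyasevich–Saidak–Zvengrowski
(Thm 1.1 via Lemmas 2.1/2.3) and Lagarias (1.4)–(1.5); the pairing sharpens it: the hypothesis is void under RH,
for `re s ≥ 1`, and at every height `t` at distance `≥ 1/2` from the ordinates of all off-line zeros.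
[cite: SondowDumitrescu2010, Thm 1] [cite: MatiyasevichSaidakZvengrowski2014, Thm 1.1 and Lemma 2.3] -/
theorem re_logDeriv_riemannXi_pos_of_offLine {s : ℂ} (hs : 1 / 2 < s.re)
    (hfar : ∀ ρ : ℂ, riemannZeta ρ = 0 → 0 < ρ.re → ρ.re < 1 → ρ.re ≠ 1 / 2 →
      (ρ.re - 1 / 2) ^ 2 < (s.re - 1 / 2) ^ 2 + (s.im - ρ.im) ^ 2) :
    0 < (logDeriv riemannXi s).re := by
  -- the hypothesis holds for ALL non-trivial zeros (on-line ones: `0 < (σ - 1/2)²`)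
  have hall : ∀ ρ : ℂ, riemannZeta ρ = 0 → 0 < ρ.re → ρ.re < 1 →
      (ρ.re - 1 / 2) ^ 2 < (s.re - 1 / 2) ^ 2 + (s.im - ρ.im) ^ 2 := by
    intro ρ hz h0 h1
    by_cases hne : ρ.re = 1 / 2
    · have h2 : (0 : ℝ) < (s.re - 1 / 2) ^ 2 := pow_pos (by linarith) 2
      rw [hne]
      nlinarith [sq_nonneg (s.im - ρ.im)]
    · exact hfar ρ hz h0 h1 hne
  -- `s` is not a zero of `ζ`
  have hζ : riemannZeta s ≠ 0 := by
    intro hz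
    by_cases h1 : s.re < 1
    · have := hall s hz (by linarith) h1
      simp at this
    · exact riemannZeta_ne_zero_of_one_le_re (not_lt.1 h1) hz
  have hsum := hasSum_zeroOrder_mul_re_inv_sub hζ
  -- the reflection `ρ ↦ 1 - conj ρ` as a permutation (involution) of the non-trivial zeros
  let φ : Equiv.Perm RHWave0.riemannZetaNontrivialZeros :=
    Function.Involutive.toPerm (fun ρ => ⟨1 - conj (ρ : ℂ), one_sub_conj_mem_nontrivialZeros ρ.2⟩)
      (fun ρ => Subtype.ext (by simp))
  have hφ : ∀ ρ : RHWave0.riemannZetaNontrivialZeros,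
      ((φ ρ : RHWave0.riemannZetaNontrivialZeros) : ℂ) = 1 - conj (ρ : ℂ) := fun ρ => rfl
  set f : RHWave0.riemannZetaNontrivialZeros → ℝ :=
    fun ρ => (riemannZetaZeroOrder (ρ : ℂ) : ℝ) * (1 / (s - ρ)).re with hf
  have hsum' : HasSum (f ∘ φ) (logDeriv riemannXi s).re := (Equiv.hasSum_iff φ).2 hsum
  have hg : HasSum (fun ρ => f ρ + f (φ ρ)) ((logDeriv riemannXi s).re + (logDeriv riemannXi s).re) :=
    hsum.add hsum'
  -- every symmetrised term is positive
  have hpos : ∀ ρ : RHWave0.riemannZetaNontrivialZeros, 0 < f ρ + f (φ ρ) := by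
    intro ρ
    obtain ⟨hz, h0, h1⟩ := mem_nontrivialZeros_iff.1 ρ.2
    have hm : (0 : ℝ) < riemannZetaZeroOrder (ρ : ℂ) := by exact_mod_cast zeroOrder_pos ρ
    have hkey := hall ρ hz h0 h1
    simp only [hf]
    rw [hφ, zeroOrder_one_sub_conj, re_inv_sub_eq', re_inv_sub_eq', ← mul_add]
    refine mul_pos hm ?_
    simp only [sub_re, one_re, conj_re, sub_im, one_im, conj_im, zero_sub, neg_neg]
    exact msz_pair_pos' hs hkey
  obtain ⟨ρ₀⟩ := nonempty_nontrivialZeros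
  have htsum : 0 < ∑' ρ, (f ρ + f (φ ρ)) :=
    hg.summable.tsum_pos (fun ρ => (hpos ρ).le) ρ₀ (hpos ρ₀)
  rw [hg.tsum_eq] at htsum
  linarith

/-- Off-line zeros at heights far from `t` do not obstruct: if every off-line zero `ρ` has
`|t − Im ρ| ≥ 1/2` then `Re ξ'/ξ(σ + it) > 0` for every `σ > 1/2`. [folklore] -/
theorem re_logDeriv_riemannXi_pos_of_offLine_height {σ t : ℝ} (hσ : 1 / 2 < σ)
    (hfar : ∀ ρ : ℂ, riemannZeta ρ = 0 → 0 < ρ.re → ρ.re < 1 → ρ.re ≠ 1 / 2 → 1 / 2 ≤ |t - ρ.im|) :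
    0 < (logDeriv riemannXi (σ + t * I)).re := by
  refine re_logDeriv_riemannXi_pos_of_offLine (by simpa using hσ) fun ρ hz h0 h1 hne => ?_
  have hu := hfar ρ hz h0 h1 hne
  have hβ : (ρ.re - 1 / 2) ^ 2 < (1 / 2) ^ 2 := by nlinarith
  have hσ' : 0 < ((σ : ℂ) + t * I).re - 1 / 2 := by simp; linarith
  have him : ((σ : ℂ) + t * I).im = t := by simp
  rw [him]
  have h14 : (1 / 2 : ℝ) ^ 2 ≤ (t - ρ.im) ^ 2 := by
    calc (1 / 2 : ℝ) ^ 2 ≤ |t - ρ.im| ^ 2 := by gcongr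
      _ = (t - ρ.im) ^ 2 := sq_abs _
  nlinarith

/-- **Lagarias (1.4), unconditionally and on the closed half-plane**: `Re ξ'/ξ(s) > 0` for `re s ≥ 1`
(every off-line zero has `|β − 1/2| < 1/2 ≤ σ − 1/2`). [cite: LagariasXiPositivity1999, eq. (1.4)] -/
theorem re_logDeriv_riemannXi_pos_of_one_le_re {s : ℂ} (hs : 1 ≤ s.re) : 0 < (logDeriv riemannXi s).re := by
  refine re_logDeriv_riemannXi_pos_of_offLine (by linarith) fun ρ _ h0 h1 _ => ?_
  have hβ : (ρ.re - 1 / 2) ^ 2 < (1 / 2) ^ 2 := by nlinarith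
  have : (1 / 2 : ℝ) ^ 2 ≤ (s.re - 1 / 2) ^ 2 := by nlinarith
  nlinarith [sq_nonneg (s.im - ρ.im)]

/-! ## From positivity of `Re ξ'/ξ` to horizontal monotonicity of `|ξ|` -/

/-- If `Re ξ'/ξ(σ + it) > 0` for all `σ > 1/2` (at a fixed height `t`), then `σ ↦ |ξ(σ + it)|` is strictly
increasing on `[1/2, ∞)`. (Mathlib's `logDeriv` is `0` at a zero, so the hypothesis includes `ξ ≠ 0` on the
open ray; the endpoint is handled by continuity.) [folklore] -/
theorem strictMonoOn_norm_riemannXi_of_re_logDeriv_pos {t : ℝ}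
    (h : ∀ σ : ℝ, 1 / 2 < σ → 0 < (logDeriv riemannXi (σ + t * I)).re) :
    StrictMonoOn (fun σ : ℝ => ‖riemannXi (σ + t * I)‖) (Ici (1 / 2)) := by
  have hne : ∀ σ : ℝ, 1 / 2 < σ → riemannXi (σ + t * I) ≠ 0 := by
    intro σ hσ h0
    have := h σ hσ
    rw [logDeriv_apply, h0, div_zero, Complex.zero_re] at this
    exact lt_irrefl _ this
  -- strict monotonicity of `log |ξ|` on the open ray
  have hlog : StrictMonoOn (fun σ : ℝ => Real.log ‖riemannXi (σ + t * I)‖) (Ioi (1 / 2)) := by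
    have hderiv : ∀ σ ∈ Ioi (1 / 2 : ℝ), HasDerivAt (fun σ : ℝ => Real.log ‖riemannXi (σ + t * I)‖)
        (logDeriv riemannXi (σ + t * I)).re σ := fun σ hσ =>
      Literature.Analysis.Complex.hasDerivAt_log_norm_horizontal
        (differentiable_riemannXi.analyticAt _) (hne σ hσ)
    refine strictMonoOn_of_deriv_pos (convex_Ioi _)
      (fun σ hσ => (hderiv σ hσ).continuousAt.continuousWithinAt) fun σ hσ => ?_
    rw [interior_Ioi] at hσ
    rw [(hderiv σ hσ).deriv]
    exact h σ hσ
  have hopen : StrictMonoOn (fun σ : ℝ => ‖riemannXi (σ + t * I)‖) (Ioi (1 / 2)) := by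
    intro a ha b hb hab
    have := hlog ha hb hab
    exact (Real.log_lt_log_iff (norm_pos_iff.2 (hne a ha)) (norm_pos_iff.2 (hne b hb))).1 this
  -- the endpoint `σ = 1/2` by continuity
  intro a ha b hb hab
  rcases (mem_Ici.1 ha).eq_or_lt with rfl | ha'
  · have hm : (1 / 2 : ℝ) < (1 / 2 + b) / 2 := by linarith
    have hmb : (1 / 2 + b) / 2 < b := by linarith
    have hle : ‖riemannXi ((1 / 2 : ℝ) + t * I)‖ ≤ ‖riemannXi ((((1 / 2 + b) / 2 : ℝ) : ℂ) + t * I)‖ := by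
      have hc : ContinuousWithinAt (fun σ : ℝ => ‖riemannXi (σ + t * I)‖) (Ioi (1 / 2)) (1 / 2) :=
        ((differentiable_riemannXi.continuous.comp (by fun_prop)).norm).continuousWithinAt
      refine le_of_tendsto hc ?_
      filter_upwards [Ioo_mem_nhdsGT hm] with σ hσ
      exact (hopen.le_iff_le hσ.1 hm).2 hσ.2.le
    exact lt_of_le_of_lt hle (hopen hm (lt_trans hm hmb) hmb)
  · exact hopen ha' (lt_trans ha' hab) hab

/-! ## The crux ⟺ cofinite Lagarias positivity ⟺ cofinite horizontal monotonicity -/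

/-- **crux ⟹ cofinite Lagarias positivity**: if only finitely many zeros are off the line, there is a
height `T` with `Re ξ'/ξ(σ + it) > 0` for all `σ > 1/2`, `|t| ≥ T`. [folklore] -/
theorem eventually_re_logDeriv_pos_of_cofinite (h : CofiniteCriticalLine) :
    ∃ T : ℝ, ∀ σ t : ℝ, 1 / 2 < σ → T ≤ |t| → 0 < (logDeriv riemannXi (σ + t * I)).re := by
  obtain ⟨M, hM⟩ := (h.image fun s : ℂ => |s.im|).bddAbove
  refine ⟨M + 1 / 2, fun σ t hσ ht => re_logDeriv_riemannXi_pos_of_offLine_height hσ ?_⟩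
  intro ρ hz h0 h1 hne
  have hρ : |ρ.im| ≤ M := hM ⟨ρ, ⟨hz, h0, h1, hne⟩, rfl⟩
  have := abs_sub_abs_le_abs_sub t ρ.im
  linarith

/-- **cofinite Lagarias positivity ⟹ crux** (cheap direction: `logDeriv` vanishes at a zero, so positivity
on `{σ > 1/2, |t| ≥ T}` excludes zeros there; reflect the left half by `s ↦ 1 − s`; bounded height ⟹
finitely many, Mathlib `IsCompact.inter_riemannZetaZeros_finite`). [folklore] -/
theorem cofinite_of_eventually_re_logDeriv_pos {T : ℝ}
    (h : ∀ σ t : ℝ, 1 / 2 < σ → T ≤ |t| → 0 < (logDeriv riemannXi (σ + t * I)).re) :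
    CofiniteCriticalLine := by
  have key : ∀ s : ℂ, riemannZeta s = 0 → 1 / 2 < s.re → s.re < 1 → T ≤ |s.im| → False := by
    intro s hz hs h1 hT
    have hξ : riemannXi s = 0 := (riemannXi_eq_zero_iff_holds s).2 ⟨hz, by linarith, h1⟩
    have := h s.re s.im hs hT
    rw [show ((s.re : ℂ) + s.im * I) = s from Complex.re_add_im s, logDeriv_apply, hξ, div_zero,
      Complex.zero_re] at this
    exact lt_irrefl _ this
  exact cofinite_of_no_rightHalf_zero_above key

/-- **R1 as a theorem, (i)**: the crux is COFINITE LAGARIAS POSITIVITY. [folklore] -/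
theorem cofiniteCriticalLine_iff_eventually_re_logDeriv_pos :
    CofiniteCriticalLine ↔
      ∃ T : ℝ, ∀ σ t : ℝ, 1 / 2 < σ → T ≤ |t| → 0 < (logDeriv riemannXi (σ + t * I)).re :=
  ⟨eventually_re_logDeriv_pos_of_cofinite, fun ⟨_, h⟩ => cofinite_of_eventually_re_logDeriv_pos h⟩

/-- **crux ⟹ cofinite Sondow–Dumitrescu / MSZ**: above some height, `σ ↦ |ξ(σ + it)|` is strictly
increasing on the WHOLE half-line `[1/2, ∞)`. [folklore] -/
theorem eventually_strictMonoOn_of_cofinite (h : CofiniteCriticalLine) :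
    ∃ T : ℝ, ∀ t : ℝ, T ≤ |t| → StrictMonoOn (fun σ : ℝ => ‖riemannXi (σ + t * I)‖) (Ici (1 / 2)) := by
  obtain ⟨T, hT⟩ := eventually_re_logDeriv_pos_of_cofinite h
  exact ⟨T, fun t ht => strictMonoOn_norm_riemannXi_of_re_logDeriv_pos fun σ hσ => hT σ t hσ ht⟩

/-- **monotonicity on a collar of width `≥ 1/2` ⟹ crux** (no rate/band hypothesis needed: every
off-line zero `β + iγ`, `β > 1/2`, lies in the collar `[1/2, 1]`, where a monotone `|ξ|` vanishing at `β`
vanishes on `[1/2, β]`, contradicting the isolatedness of zeros of `ξ`; `ξ(0) = 1/2`). Stated for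
`MonotoneOn` on `Icc (1/2) (1/2 + ε₀)`, `ε₀ ≥ 1/2`. [folklore] -/
theorem cofinite_of_eventually_monotoneOn {T ε₀ : ℝ} (hε₀ : 1 / 2 ≤ ε₀)
    (h : ∀ t : ℝ, T ≤ |t| → MonotoneOn (fun σ : ℝ => ‖riemannXi (σ + t * I)‖) (Icc (1 / 2) (1 / 2 + ε₀))) :
    CofiniteCriticalLine := by
  have key : ∀ s : ℂ, riemannZeta s = 0 → 1 / 2 < s.re → s.re < 1 → T ≤ |s.im| → False := by
    intro s hz hs h1 hT
    have hmono := h s.im hT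
    have hξs : riemannXi s = 0 := (riemannXi_eq_zero_iff_holds s).2 ⟨hz, by linarith, h1⟩
    -- `|ξ|` vanishes on the segment `[1/2, re s] + i·im s`
    have hzero : ∀ σ : ℝ, 1 / 2 ≤ σ → σ ≤ s.re → riemannXi (σ + s.im * I) = 0 := by
      intro σ h1σ hσs
      have hle := hmono ⟨h1σ, by linarith⟩ ⟨hs.le, by linarith⟩ hσs
      simp only [Complex.re_add_im, hξs, norm_zero] at hle
      exact norm_eq_zero.1 (le_antisymm hle (norm_nonneg _))
    -- isolated zeros of the entire, not identically zero `ξ`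
    have han : AnalyticAt ℂ riemannXi s := differentiable_riemannXi.analyticAt s
    rcases han.eventually_eq_zero_or_eventually_ne_zero with hev | hev
    · have hall := AnalyticOnNhd.eqOn_zero_of_preconnected_of_eventuallyEq_zero
        (fun z _ => differentiable_riemannXi.analyticAt z) isPreconnected_univ (mem_univ s) hev
      have h00 := hall (mem_univ (0 : ℂ))
      rw [riemannXi_zero] at h00
      norm_num at h00
    · rw [eventually_nhdsWithin_iff, Metric.eventually_nhds_iff] at hev
      obtain ⟨δ, hδ, hδ'⟩ := hev
      set m : ℝ := min (δ / 2) ((s.re - 1 / 2) / 2) with hm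
      have hm0 : 0 < m := lt_min (by linarith) (by linarith)
      have hz' := hzero (s.re - m) (by linarith [min_le_right (δ / 2) ((s.re - 1 / 2) / 2)])
        (by linarith)
      have hpt : (((s.re - m : ℝ) : ℂ) + s.im * I) = s - m := by
        apply Complex.ext <;> simp
      rw [hpt] at hz'
      refine hδ' (y := s - m) ?_ ?_ hz'
      · rw [dist_eq_norm, sub_sub_cancel_left, norm_neg, Complex.norm_real, Real.norm_eq_abs,
          abs_of_pos hm0]
        linarith [min_le_left (δ / 2) ((s.re - 1 / 2) / 2)]
      · rw [mem_compl_singleton_iff, Ne, sub_eq_self]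
        exact_mod_cast hm0.ne'
  exact cofinite_of_no_rightHalf_zero_above key

/-- **R1 as a theorem, (ii)**: the crux is COFINITE SONDOW–DUMITRESCU MONOTONICITY on the whole
half-line. [folklore] -/
theorem cofiniteCriticalLine_iff_eventually_strictMonoOn :
    CofiniteCriticalLine ↔
      ∃ T : ℝ, ∀ t : ℝ, T ≤ |t| → StrictMonoOn (fun σ : ℝ => ‖riemannXi (σ + t * I)‖) (Ici (1 / 2)) := by
  refine ⟨eventually_strictMonoOn_of_cofinite, fun ⟨T, hT⟩ => ?_⟩
  refine cofinite_of_eventually_monotoneOn (ε₀ := 1 / 2) le_rfl (T := T) fun t ht => ?_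
  exact ((hT t ht).mono (Icc_subset_Ici_self)).monotoneOn

end Summit.RiemannHypothesis.Cruxes.CofiniteCriticalLine.Negative

end
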